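import Summits.MatrixMultiplication.OmegaCensus.STPPVosperTilingLaw

/-!
# ω-census (abelian STPP census): the exact-cover stage for a GENERAL `Y°`-shape (kernel, UNCONDITIONAL)

HONEST FRAMING (pub-omega census; verbatim): lottery ticket; floor = certified bounds/negative ranges.
Census STRUCTURE (seat pub-omega-stpp-1 gen 31, 2026-08-28), family (b2).  `STPPVosperTilingLaw.lean` (stpp-1 g30) runs the exact-cover checker
`existsCover` when `Y° = ⋃_{k≠i}(C_k − B_k)` is a PROGRESSION (`{(j t) mod p : t < L}` after normalisation).  The slack-1 cases need other shapes: in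
case α₂ (`|Aᵢ| = 2`) `Y°` is the union of TWO progressions of the same step.  THIS FILE factors the cover stage out of the tiling law, for an ARBITRARY
description of `Y°` by a duplicate-free list of values: if `Z° = ⋃_{k≠i}(C_k − A_k)` is a `z`-term progression of step `e′`, and the values
`(e′⁻¹ (x − y₀)).val`, `x ∈ Y°`, form exactly the list `YL`, then the sound search `existsCover p z YL (sizes of the other blocks) [] []` returns `true`
(`existsCover_true_of_isSTPP`).  A law that has `decide`d the search to be `false` therefore kills the family.  No Hamidoune–Rødseth; nothing here is
progress on `ω`.

Proof = the normalisation of `no_isSTPP_of_tight_tiling_prime` verbatim (one translation `b*_k ∈ B_k` per block, `C′ = u(C − b* − y₀)`,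
`A′ = u(A − b* − y₀ + z₀)`, `u = e′⁻¹`; injectivity from the triple product property, disjointness across blocks from the STPP, coverage from
`Y° = ⋃ (C_k − B_k)`, `Z° = ⋃ (C_k − A_k)`), with the two places that used the progression shape of `Y°` replaced by the abstract hypotheses `hYin`, `hYsurj`.

References: A. G. Vosper, J. London Math. Soc. 31 (1956); M. B. Nathanson, GTM 165, Thm 2.7; H. Cohn, R. Kleinberg, B. Szegedy, C. Umans, FOCS 2005
(arXiv:math/0511460), Def. 5.1.
-/

open Finset
open scoped Pointwise

namespace Summit.MatrixMultiplication.OmegaCensus.CubeNB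

open Literature.Computability.AlgebraicComplexity
open Literature.Combinatorics.Additive
open Summit.MatrixMultiplication.OmegaCensus.STPPKneser

variable {p : ℕ} [hp : Fact p.Prime] {N : ℕ} {A B C : Fin N → Finset (ZMod p)}

/-- **The exact-cover stage, general `Y°`-shape (kernel, UNCONDITIONAL).**  Let `(A, B, C)` be an STPP family with non-empty sets, `i` a block,
`ks` the duplicate-free list of the other indices, `Z° = ⋃_{k≠i}(C_k − A_k) = {z₀ + t e′ : t < z}` a progression (`e′ ≠ 0`), and `YL` a
duplicate-free list of naturals which is EXACTLY the set of values `(e′⁻¹ (x − y₀)).val` for `x ∈ Y° = ⋃_{k≠i}(C_k − B_k)`.  Then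
`existsCover p z YL (ks.map sizes) [] [] = true`. [cite: CohnKleinbergSzegedyUmans2005, Def. 5.1] -/
theorem existsCover_true_of_isSTPP (hS : IsSTPP A B C) (hA : ∀ k, (A k).Nonempty) (hB : ∀ k, (B k).Nonempty) (hC : ∀ k, (C k).Nonempty)
    (i : Fin N) (ks : List (Fin N)) (hks : ks.Nodup) (hksi : ∀ k, k ∈ ks ↔ k ≠ i)
    {e' : ZMod p} (he' : e' ≠ 0) {z : ℕ} {z₀ : ZMod p} (hzo : DU A C (univ.erase i) = apFinset z₀ e' z)
    (hZocard : #(DU A C (univ.erase i)) = z) {YL : List ℕ} (hYLnd : YL.Nodup) {y₀ : ZMod p}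
    (hYin : ∀ x ∈ DU B C (univ.erase i), (e'⁻¹ * (x - y₀)).val ∈ YL)
    (hYsurj : ∀ y ∈ YL, ∃ x ∈ DU B C (univ.erase i), (e'⁻¹ * (x - y₀)).val = y) :
    existsCover p z YL (ks.map fun k => (#(A k), #(B k), #(C k))) [] [] = true := by
  set u : ZMod p := e'⁻¹ with hu
  have hu0 : u ≠ 0 := inv_ne_zero he'
  have hue : u * e' = 1 := inv_mul_cancel₀ he'
  have hbs : ∀ k, ∃ x, x ∈ B k := fun k => hB k
  choose bs hbsmem using hbs
  set φB : Fin N → ZMod p → ZMod p := fun k x => u * (x - bs k) with hφB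
  set φC : Fin N → ZMod p → ZMod p := fun k x => u * (x - bs k - y₀) with hφC
  set φA : Fin N → ZMod p → ZMod p := fun k x => u * (x - bs k - y₀ + z₀) with hφA
  have hinjB : ∀ k, Function.Injective (φB k) := fun k x x' h => by
    have := mul_left_cancel₀ hu0 h; simpa using this
  have hinjC : ∀ k, Function.Injective (φC k) := fun k x x' h => by
    have := mul_left_cancel₀ hu0 h; simpa using this
  have hinjA : ∀ k, Function.Injective (φA k) := fun k x x' h => by
    have := mul_left_cancel₀ hu0 h; simpa using this
  have hvinj : Function.Injective (ZMod.val : ZMod p → ℕ) := ZMod.val_injective p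
  set Av : Fin N → Finset ℕ := fun k => (A k).image (fun x => (φA k x).val) with hAv
  set Bv : Fin N → Finset ℕ := fun k => (B k).image (fun x => (φB k x).val) with hBv
  set Cv : Fin N → Finset ℕ := fun k => (C k).image (fun x => (φC k x).val) with hCv
  -- differences of normalised values
  have hdiffCB : ∀ k, ∀ c₀ ∈ C k, ∀ b₀ ∈ B k, ((φC k c₀).val + p - (φB k b₀).val) % p = (u * (c₀ - b₀ - y₀)).val := by
    intro k c₀ _ b₀ _
    rw [← val_sub_eq_mod]
    congr 1
    simp only [hφC, hφB]; ring
  have hdiffCA : ∀ k, ∀ c₀ ∈ C k, ∀ a₀ ∈ A k, ((φC k c₀).val + p - (φA k a₀).val) % p = (u * (c₀ - a₀ - z₀)).val := by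
    intro k c₀ _ a₀ _
    rw [← val_sub_eq_mod]
    congr 1
    simp only [hφC, hφA]; ring
  have hdiffAB : ∀ k, ∀ a₀ ∈ A k, ∀ b₀ ∈ B k, ((φA k a₀).val + p - (φB k b₀).val) % p = (u * (a₀ - b₀ - y₀ + z₀)).val := by
    intro k a₀ _ b₀ _
    rw [← val_sub_eq_mod]
    congr 1
    simp only [hφA, hφB]; ring
  -- elements of the difference sets of other blocks lie in Y° / Z°
  have hYmem : ∀ k, k ≠ i → ∀ c₀ ∈ C k, ∀ b₀ ∈ B k, c₀ - b₀ ∈ DU B C (univ.erase i) := fun k hk c₀ hc₀ b₀ hb₀ =>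
    D_subset_DU (Finset.mem_erase.2 ⟨hk, Finset.mem_univ k⟩) (mem_D.2 ⟨b₀, hb₀, c₀, hc₀, rfl⟩)
  have hZmem : ∀ k, k ≠ i → ∀ c₀ ∈ C k, ∀ a₀ ∈ A k, ∃ t, t < z ∧ c₀ - a₀ = z₀ + t • e' := by
    intro k hk c₀ hc₀ a₀ ha₀
    have h : c₀ - a₀ ∈ DU A C (univ.erase i) :=
      D_subset_DU (Finset.mem_erase.2 ⟨hk, Finset.mem_univ k⟩) (mem_D.2 ⟨a₀, ha₀, c₀, hc₀, rfl⟩)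
    rw [hzo, mem_apFinset] at h
    obtain ⟨t, ht, h⟩ := h
    exact ⟨t, ht, h.symm⟩
  have hzp : z ≤ p := by have h := Finset.card_le_univ (DU A C (univ.erase i)); rwa [hZocard, ZMod.card] at h
  have hvalZt : ∀ t : ℕ, t < z → (u * (z₀ + t • e' - z₀)).val = t := by
    intro t ht
    have : u * (z₀ + t • e' - z₀) = (t : ZMod p) := by rw [nsmul_eq_mul]; linear_combination (t : ZMod p) * hue
    rw [this, ZMod.val_natCast, Nat.mod_eq_of_lt (by omega)]
  -- run the sound search
  have hiA : ∀ k, Function.Injective (fun x => (φA k x).val) := fun k x x' h => hinjA k (hvinj h)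
  have hiB : ∀ k, Function.Injective (fun x => (φB k x).val) := fun k x x' h => hinjB k (hvinj h)
  have hiC : ∀ k, Function.Injective (fun x => (φC k x).val) := fun k x x' h => hinjC k (hvinj h)
  have hksne : ∀ k ∈ ks, k ≠ i := fun k hk => (hksi k).1 hk
  refine existsCover_complete (p := p) (z := z) hYLnd (fun k => k ≠ i) (fun k => (#(A k), #(B k), #(C k))) Av Bv Cv
    (fun k _ => by simp only [hAv]; rw [Finset.card_image_of_injective _ (hiA k)])
    (fun k _ => by simp only [hBv]; rw [Finset.card_image_of_injective _ (hiB k)])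
    (fun k _ => by simp only [hCv]; rw [Finset.card_image_of_injective _ (hiC k)])
    (fun k x hx => by obtain ⟨y, -, rfl⟩ := Finset.mem_image.1 hx; exact ZMod.val_lt _)
    (fun k x hx => by obtain ⟨y, -, rfl⟩ := Finset.mem_image.1 hx; exact ZMod.val_lt _)
    (fun k x hx => by obtain ⟨y, -, rfl⟩ := Finset.mem_image.1 hx; exact ZMod.val_lt _)
    (fun k _ => Finset.mem_image.2 ⟨bs k, hbsmem k, by simp [hφB]⟩)
    ?hY ?hZ ?hinjY ?hinjZ ?hinjX ks hks hksne [] [] (by simp) ?hdY ?hcY (by simp) ?hdZ ?hcZ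
  case hY =>
    intro k hk c hc x hx
    obtain ⟨c₀, hc₀, rfl⟩ := Finset.mem_image.1 hc
    obtain ⟨b₀, hb₀, rfl⟩ := Finset.mem_image.1 hx
    rw [hdiffCB k c₀ hc₀ b₀ hb₀]
    exact hYin _ (hYmem k hk c₀ hc₀ b₀ hb₀)
  case hZ =>
    intro k hk c hc x hx
    obtain ⟨c₀, hc₀, rfl⟩ := Finset.mem_image.1 hc
    obtain ⟨a₀, ha₀, rfl⟩ := Finset.mem_image.1 hx
    obtain ⟨t, ht, hca⟩ := hZmem k hk c₀ hc₀ a₀ ha₀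
    rw [hdiffCA k c₀ hc₀ a₀ ha₀, hca, hvalZt t ht]
    exact ht
  case hinjY =>
    intro k _ c hc c' hc' x hx x' hx' heq
    obtain ⟨c₀, hc₀, rfl⟩ := Finset.mem_image.1 hc
    obtain ⟨c₁, hc₁, rfl⟩ := Finset.mem_image.1 hc'
    obtain ⟨b₀, hb₀, rfl⟩ := Finset.mem_image.1 hx
    obtain ⟨b₁, hb₁, rfl⟩ := Finset.mem_image.1 hx'
    rw [hdiffCB k c₀ hc₀ b₀ hb₀, hdiffCB k c₁ hc₁ b₁ hb₁] at heq
    have h1 : c₀ - b₀ = c₁ - b₁ := by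
      have := mul_left_cancel₀ hu0 (hvinj heq); linear_combination this
    obtain ⟨e1, e2⟩ := sub_injOn_of_card_D (card_D_BC hS hA k) hb₀ hb₁ hc₀ hc₁ h1
    exact ⟨by rw [e2], by rw [e1]⟩
  case hinjZ =>
    intro k _ c hc c' hc' x hx x' hx' heq
    obtain ⟨c₀, hc₀, rfl⟩ := Finset.mem_image.1 hc
    obtain ⟨c₁, hc₁, rfl⟩ := Finset.mem_image.1 hc'
    obtain ⟨a₀, ha₀, rfl⟩ := Finset.mem_image.1 hx
    obtain ⟨a₁, ha₁, rfl⟩ := Finset.mem_image.1 hx'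
    rw [hdiffCA k c₀ hc₀ a₀ ha₀, hdiffCA k c₁ hc₁ a₁ ha₁] at heq
    have h1 : c₀ - a₀ = c₁ - a₁ := by
      have := mul_left_cancel₀ hu0 (hvinj heq); linear_combination this
    obtain ⟨e1, e2⟩ := sub_injOn_of_card_D (card_D_AC hS hB k) ha₀ ha₁ hc₀ hc₁ h1
    exact ⟨by rw [e2], by rw [e1]⟩
  case hinjX =>
    intro k _ c hc c' hc' x hx x' hx' heq
    obtain ⟨a₀, ha₀, rfl⟩ := Finset.mem_image.1 hc
    obtain ⟨a₁, ha₁, rfl⟩ := Finset.mem_image.1 hc'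
    obtain ⟨b₀, hb₀, rfl⟩ := Finset.mem_image.1 hx
    obtain ⟨b₁, hb₁, rfl⟩ := Finset.mem_image.1 hx'
    rw [hdiffAB k a₀ ha₀ b₀ hb₀, hdiffAB k a₁ ha₁ b₁ hb₁] at heq
    have h1 : b₀ - a₀ = b₁ - a₁ := by
      have := mul_left_cancel₀ hu0 (hvinj heq); linear_combination (-1 : ZMod p) * this
    obtain ⟨e1, e2⟩ := sub_injOn_of_card_D (card_D_AB hS hC k) ha₀ ha₁ hb₀ hb₁ h1
    exact ⟨by rw [e1], by rw [e2]⟩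
  case hdY =>
    intro k hk k' hk' hne c hc x hx c' hc' x' hx' heq
    obtain ⟨c₀, hc₀, rfl⟩ := Finset.mem_image.1 hc
    obtain ⟨b₀, hb₀, rfl⟩ := Finset.mem_image.1 hx
    obtain ⟨c₁, hc₁, rfl⟩ := Finset.mem_image.1 hc'
    obtain ⟨b₁, hb₁, rfl⟩ := Finset.mem_image.1 hx'
    rw [hdiffCB k c₀ hc₀ b₀ hb₀, hdiffCB k' c₁ hc₁ b₁ hb₁] at heq
    have h1 : c₀ - b₀ = c₁ - b₁ := by
      have := mul_left_cancel₀ hu0 (hvinj heq); linear_combination this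
    have hm0 : c₀ - b₀ ∈ D B C k := mem_D.2 ⟨b₀, hb₀, c₀, hc₀, rfl⟩
    have hm1 : c₁ - b₁ ∈ D B C k' := mem_D.2 ⟨b₁, hb₁, c₁, hc₁, rfl⟩
    rw [h1] at hm0
    exact Finset.disjoint_left.1 (disjoint_D_BC hS hA hne) hm0 hm1
  case hcY =>
    intro y hyin
    obtain ⟨x, hxYo, hxy⟩ := hYsurj y hyin
    obtain ⟨k, hk, hyk⟩ := Finset.mem_biUnion.1 hxYo
    obtain ⟨b₀, hb₀, c₀, hc₀, hcb⟩ := mem_D.1 hyk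
    refine Or.inr ⟨k, (hksi k).2 (Finset.mem_erase.1 hk).1, (φC k c₀).val, Finset.mem_image.2 ⟨c₀, hc₀, rfl⟩,
      (φB k b₀).val, Finset.mem_image.2 ⟨b₀, hb₀, rfl⟩, ?_⟩
    rw [hdiffCB k c₀ hc₀ b₀ hb₀, hcb, ← hxy]
  case hdZ =>
    intro k hk k' hk' hne c hc x hx c' hc' x' hx' heq
    obtain ⟨c₀, hc₀, rfl⟩ := Finset.mem_image.1 hc
    obtain ⟨a₀, ha₀, rfl⟩ := Finset.mem_image.1 hx
    obtain ⟨c₁, hc₁, rfl⟩ := Finset.mem_image.1 hc'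
    obtain ⟨a₁, ha₁, rfl⟩ := Finset.mem_image.1 hx'
    rw [hdiffCA k c₀ hc₀ a₀ ha₀, hdiffCA k' c₁ hc₁ a₁ ha₁] at heq
    have h1 : c₀ - a₀ = c₁ - a₁ := by
      have := mul_left_cancel₀ hu0 (hvinj heq); linear_combination this
    have hm0 : c₀ - a₀ ∈ D A C k := mem_D.2 ⟨a₀, ha₀, c₀, hc₀, rfl⟩
    have hm1 : c₁ - a₁ ∈ D A C k' := mem_D.2 ⟨a₁, ha₁, c₁, hc₁, rfl⟩
    rw [h1] at hm0
    exact Finset.disjoint_left.1 (disjoint_D_AC hS hB hne) hm0 hm1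
  case hcZ =>
    intro t ht
    have hmem : z₀ + t • e' ∈ DU A C (univ.erase i) := by rw [hzo]; exact mem_apFinset.2 ⟨t, ht, rfl⟩
    obtain ⟨k, hk, hzk⟩ := Finset.mem_biUnion.1 hmem
    obtain ⟨a₀, ha₀, c₀, hc₀, hca⟩ := mem_D.1 hzk
    refine Or.inr ⟨k, (hksi k).2 (Finset.mem_erase.1 hk).1, (φC k c₀).val, Finset.mem_image.2 ⟨c₀, hc₀, rfl⟩,
      (φA k a₀).val, Finset.mem_image.2 ⟨a₀, ha₀, rfl⟩, ?_⟩
    rw [hdiffCA k c₀ hc₀ a₀ ha₀, hca, hvalZt t ht]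

end Summit.MatrixMultiplication.OmegaCensus.CubeNB
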